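import Summits.NavierStokesRegularity.NavierStokesRegularity.Theorems.PerpetualPumpAveragedTypeIBlowupChainCritical
import Summits.NavierStokesRegularity.NavierStokesRegularity.Theorems.PerpetualPumpAveragedTypeIBlowupChainCriticalC1
import Summits.NavierStokesRegularity.NavierStokesRegularity.Theorems.PerpetualPumpAveragedTypeIBlowupTailOfWeight
import Summits.NavierStokesRegularity.NavierStokesRegularity.Theorems.PerpetualPumpAveragedTypeIBlowupExtendOfApriori

/-!
# Crux `PerpetualPump.AveragedTypeIBlowup` (stmt-NavierStokesRegularity-1835), line `Sketch`:
# tools for the stub `stepExists` — the bridge package, transfer of the hand-off invariant,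
# and the a-priori `H¹⁰` bound from the tube

T. Tao, *Finite time blowup for an averaged three-dimensional Navier–Stokes equation*, J. Amer.
Math. Soc. **29** (2016), 601–674 = arXiv:1402.0290v3, §4 p. 22 (4.14): the wavelet coefficients of
a mild solution of the cascade equation solve the exact Volterra chain
`Y_{i,n}(t) = A 1_{(i,n)=(0,0)} k_{i,n}(t) + ∫₀ᵗ k_{i,n}(t-s) quadTerm(Y)_{i,n}(s) ds` with the mode heat
kernels `k_{i,n}(τ) = Re⟨e^{τΔ}ψ_{i,n}, ψ_{i,n}⟩`, `|k_{i,n}| ≤ 1`.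

Helper file (theorems only) for the registered stub `stub_stepExists` of the lead's skeleton
`Cruxes/AveragedTypeIBlowup/Lines/Sketch.lean` (existence of a solution of the seeded-Toda chain living
beyond a certified next hand-off). In the let-free tree vocabulary of that stub (structure constants
`α`, kernels `kern`, critical observables `bvo, wvo`, kernel majorants `M0o, M1o`, rates `R`, ladder
profile `lad`, all pinned by defining equations):

* `stepExists_kernel` — `|kern| ≤ 1` and continuity (`stub_kernel`, `tailOfWeight_kernel_mem`);
* `stepExists_obs_congr` — the observables `bvo, wvo, M0o, M1o` at times `s ≤ t` only read the
  solution on `[0,t]` (`quadTerm_congr_at` under the memory integral);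
* `stepExists_inv_transfer` — hence the hand-off invariant `Invo A Y m Bm t` transfers between two
  solutions agreeing on `[0,t]`;
* `stepExists_critical` — for a solution of the chain on `[0,S)` and a horizon `0 < T < S`, the full
  hypothesis package of the window one-step theorem: vanishing below the front `0`, continuity, the
  C¹ critical Toda system with memory errors (`chainCriticalC1_of_kernels`), majorant domination and
  restart (`chainCritical_of_kernels`), and the a-priori far tail (`stub_tailOfWeight`);
* `stepExists_weight_class/front/tail`, `stepExists_apriori` — the `(1+ε₀)^{10n}` a-priori bound of
  a solution in the one-step tube after `t₀` and in the class before `t₀`;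
* `stub_stepExistsTools` — the registered tools stub (the three weight inequalities).

Nothing here closes the item (`--supports`); no statement of the route changes.

## References

* T. Tao, J. Amer. Math. Soc. 29 (2016), 601–674, arXiv:1402.0290v3, §4 p. 22 (4.14).
  [`Tao2016AveragedNS`]
-/

noncomputable section

-- the summit namespace `…NavierStokesRegularity.NavierStokesRegularity…` is the tree convention
set_option linter.dupNamespace false

open MeasureTheory Set Filter Topology
open scoped ENNReal
open Literature.Analysis.FluidPDE Literature.Analysis.FluidPDE.Tao2016
open Literature.Analysis.FluidPDE.TaoCascade (quadTerm IsSymmetricCoeff IsCancellingCoeff)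

namespace Summit.NavierStokesRegularity.NavierStokesRegularity.Theorems.PerpetualPumpAveragedTypeIBlowup

variable {ε₀ : ℝ}

/-! ### The kernels and the observables -/

/-- The mode heat kernels `k_{i,n}(τ) = Re⟨e^{τΔ}ψ_{i,n}, ψ_{i,n}⟩ = ∫ e^{-λ(ξ) max(τ,0)} ρ_{i,n}(ξ) dξ`
are bounded by `1` in absolute value and continuous. [cite: Tao2016AveragedNS, §4 p. 22 (4.14)] -/
theorem stepExists_kernel (hε₀ : 0 < ε₀) (hε₁ : ε₀ ≤ 1) (𝒟 : CascadeWaveletData ε₀ 2)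
    {kern : Fin 2 → ℤ → ℝ → ℝ}
    (hkern : ∀ (i : Fin 2) (n : ℤ) (τ : ℝ),
      kern i n τ = (pairing (heat τ (cascadeWavelet ε₀ (𝒟.ψ i) n)) (cascadeWavelet ε₀ (𝒟.ψ i) n)).re) :
    (∀ i n τ, |kern i n τ| ≤ 1) ∧ (∀ i n, Continuous (kern i n)) := by
  refine ⟨fun i n τ => ?_, fun i n => ?_⟩
  · rw [hkern, re_pairing_heat_cascadeWavelet_self]
    obtain ⟨h0, h1⟩ := tailOfWeight_kernel_mem (by linarith) 𝒟 i n (le_max_right τ 0)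
    rw [abs_of_nonneg h0]
    exact h1
  · have h : kern i n = fun τ =>
        (pairing (heat τ (cascadeWavelet ε₀ (𝒟.ψ i) n)) (cascadeWavelet ε₀ (𝒟.ψ i) n)).re :=
      funext (hkern i n)
    rw [h]
    exact (stub_kernel hε₀ hε₁ 𝒟 i n).2.2.2.1

/-- **Locality of the observables.** The critical observables `b, w` and the kernel majorants `M0, M1`
of a coefficient family at a time `s ∈ [0,t]` only read the family on `[0,t]` (the drive `quadTerm` is
evaluated pointwise in time, `quadTerm_congr_at`). [folklore] -/
theorem stepExists_obs_congr (𝒟 : CascadeWaveletData ε₀ 2) (α : Fin 2 → Fin 2 → Fin 2 → ℤ × ℤ × ℤ → ℝ)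
    (bvo wvo : (Fin 2 → ℤ → ℝ → ℝ) → ℤ → ℝ → ℝ) (M0o M1o : ℝ → (Fin 2 → ℤ → ℝ → ℝ) → ℤ → ℝ → ℝ)
    (hbvo : ∀ (Y : Fin 2 → ℤ → ℝ → ℝ) (n : ℤ) (t : ℝ), bvo Y n t = -((1 + ε₀) ^ ((n : ℝ) / 2) * Y 0 n t))
    (hwvo : ∀ (Y : Fin 2 → ℤ → ℝ → ℝ) (n : ℤ) (t : ℝ), wvo Y n t = (1 + ε₀) ^ ((n : ℝ) / 2) * Y 1 n t)
    (hM0o : ∀ (A : ℝ) (Y : Fin 2 → ℤ → ℝ → ℝ) (n : ℤ) (t : ℝ), M0o A Y n t = (1 + ε₀) ^ ((n : ℝ) / 2) *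
      ((if n = 0 then |A| else 0) * (∫ ξ, Real.exp (-(heatRate ξ * t)) * modeWeight 𝒟 0 n ξ) +
        ∫ s in (0 : ℝ)..t, (∫ ξ, Real.exp (-(heatRate ξ * (t - s))) * modeWeight 𝒟 0 n ξ) *
          |quadTerm ε₀ α Y 0 n s|))
    (hM1o : ∀ (A : ℝ) (Y : Fin 2 → ℤ → ℝ → ℝ) (n : ℤ) (t : ℝ), M1o A Y n t = (1 + ε₀) ^ ((n : ℝ) / 2) *
      ∫ s in (0 : ℝ)..t, (∫ ξ, Real.exp (-(heatRate ξ * (t - s))) * modeWeight 𝒟 1 n ξ) *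
        |quadTerm ε₀ α Y 1 n s|)
    {A t : ℝ} {Y Y' : Fin 2 → ℤ → ℝ → ℝ} (h : ∀ (i : Fin 2) (k : ℤ), ∀ s ∈ Icc 0 t, Y' i k s = Y i k s) :
    ∀ k : ℤ, ∀ s ∈ Icc 0 t, bvo Y' k s = bvo Y k s ∧ wvo Y' k s = wvo Y k s ∧
      M0o A Y' k s = M0o A Y k s ∧ M1o A Y' k s = M1o A Y k s := by
  intro k s hs
  have hQ : ∀ i : Fin 2,
      (∫ u in (0 : ℝ)..s, (∫ ξ, Real.exp (-(heatRate ξ * (s - u))) * modeWeight 𝒟 i k ξ) *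
        |quadTerm ε₀ α Y' i k u|) =
      ∫ u in (0 : ℝ)..s, (∫ ξ, Real.exp (-(heatRate ξ * (s - u))) * modeWeight 𝒟 i k ξ) *
        |quadTerm ε₀ α Y i k u| := fun i =>
    intervalIntegral.integral_congr fun u hu => by
      rw [uIcc_of_le hs.1] at hu
      simp only [quadTerm_congr_at α (fun j k' => h j k' u ⟨hu.1, hu.2.trans hs.2⟩) i k]
  rw [hbvo, hbvo, hwvo, hwvo, hM0o, hM0o, hM1o, hM1o, h 0 k s hs, h 1 k s hs, hQ 0, hQ 1]
  exact ⟨rfl, rfl, rfl, rfl⟩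

/-- **Transfer of the hand-off invariant.** The hand-off invariant `Invo A Y m Bm t` of the window
one-step theorem only involves the observables at times in `[0,t]`; so it transfers from `Y` to any
family `Y'` with the same observables on `[0,t]`. [folklore] -/
theorem stepExists_inv_transfer (F εb q bhi : ℝ) (lad : ℕ → ℝ)
    (bvo wvo : (Fin 2 → ℤ → ℝ → ℝ) → ℤ → ℝ → ℝ) (M0o M1o : ℝ → (Fin 2 → ℤ → ℝ → ℝ) → ℤ → ℝ → ℝ)
    (Invo : ℝ → (Fin 2 → ℤ → ℝ → ℝ) → ℤ → ℝ → ℝ → Prop)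
    (hInvo : ∀ (A : ℝ) (Y : Fin 2 → ℤ → ℝ → ℝ) (m : ℤ) (Bm t : ℝ), Invo A Y m Bm t ↔
      (bvo Y m t = Bm ∧ (∀ s ∈ Icc 0 t, bvo Y m s ≤ Bm) ∧
      (0 ≤ wvo Y m t ∧ wvo Y m t ≤ F * εb * Bm ∧ M1o A Y m t ≤ F * εb * Bm ∧ M0o A Y m t ≤ 2 * Bm) ∧
      (0 ≤ m - 1 → 0 ≤ wvo Y (m - 1) t ∧ q ^ 3 * Bm - 1 ≤ (wvo Y (m - 1) t) ^ 2 ∧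
        (wvo Y (m - 1) t) ^ 2 ≤ q ^ 3 * Bm + 1 ∧ 9 / 20 ≤ bvo Y (m - 1) t ∧ bvo Y (m - 1) t ≤ 11 / 20 ∧
        M0o A Y (m - 1) t ≤ 5 * (bhi + 4) ^ 2 ∧ M1o A Y (m - 1) t ≤ 5 * (bhi + 4) ^ 2) ∧
      (|bvo Y (m + 1) t| ≤ εb ∧ |wvo Y (m + 1) t| ≤ εb ∧ M0o A Y (m + 1) t ≤ εb ∧ M1o A Y (m + 1) t ≤ εb) ∧
      (∀ j : ℕ, 2 ≤ j → |bvo Y (m + j) t| ≤ lad j ∧ |wvo Y (m + j) t| ≤ lad j / 5 ∧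
        M0o A Y (m + j) t ≤ lad j ∧ M1o A Y (m + j) t ≤ lad j) ∧
      (∀ j : ℕ, 1 ≤ j → ∀ s ∈ Icc 0 t, bvo Y (m + j) s ≤ 1 / 2) ∧
      (∀ k : ℤ, 0 ≤ k → k ≤ m - 2 → ∃ te ∈ Icc 0 t,
        (-(2 / 5) ≤ bvo Y k te ∧ bvo Y k te ≤ 3 / 10 ∧ |wvo Y k te| ≤ 1 / 200 ∧
          M0o A Y k te ≤ 10 * (bhi + 4) ^ 2 ∧ M1o A Y k te ≤ 10 * (bhi + 4) ^ 2) ∧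
        ∀ s ∈ Icc te t, -(9 / 20) ≤ bvo Y k s ∧ bvo Y k s ≤ 7 / 20 ∧ |wvo Y k s| ≤ 1 / 100 ∧
          M0o A Y k s ≤ 10 * (bhi + 4) ^ 2 + 1 ∧ M1o A Y k s ≤ 10 * (bhi + 4) ^ 2 + 1 ∧
          |wvo Y (k - 1) s| ≤ 1 / 100 ∧ -(1 / 2) ≤ bvo Y (k + 1) s ∧ bvo Y (k + 1) s ≤ 9 / 10)))
    {A t : ℝ} {Y Y' : Fin 2 → ℤ → ℝ → ℝ} (ht : 0 ≤ t)
    (h : ∀ k : ℤ, ∀ s ∈ Icc 0 t, bvo Y' k s = bvo Y k s ∧ wvo Y' k s = wvo Y k s ∧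
      M0o A Y' k s = M0o A Y k s ∧ M1o A Y' k s = M1o A Y k s)
    {m : ℤ} {Bm : ℝ} (hI : Invo A Y m Bm t) : Invo A Y' m Bm t := by
  have htt : t ∈ Icc 0 t := ⟨ht, le_rfl⟩
  have hb := fun k s hs => (h k s hs).1
  have hw := fun k s hs => (h k s hs).2.1
  have h0 := fun k s hs => (h k s hs).2.2.1
  have h1 := fun k s hs => (h k s hs).2.2.2
  rw [hInvo] at hI ⊢
  obtain ⟨c1, c2, c3, c4, c5, c6, c7, c8⟩ := hI
  refine ⟨?_, fun s hs => ?_, ?_, fun hm => ?_, ?_, fun j hj => ?_, fun j hj s hs => ?_,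
    fun k hk hkm => ?_⟩
  · rw [hb m t htt]; exact c1
  · rw [hb m s hs]; exact c2 s hs
  · rw [hw m t htt, h0 m t htt, h1 m t htt]; exact c3
  · rw [hw (m - 1) t htt, hb (m - 1) t htt, h0 (m - 1) t htt, h1 (m - 1) t htt]; exact c4 hm
  · rw [hb (m + 1) t htt, hw (m + 1) t htt, h0 (m + 1) t htt, h1 (m + 1) t htt]; exact c5
  · rw [hb (m + j) t htt, hw (m + j) t htt, h0 (m + j) t htt, h1 (m + j) t htt]; exact c6 j hj
  · rw [hb (m + j) s hs]; exact c7 j hj s hs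
  · obtain ⟨te, hte, cA, cB⟩ := c8 k hk hkm
    refine ⟨te, hte, ?_, fun s hs => ?_⟩
    · rw [hb k te hte, hw k te hte, h0 k te hte, h1 k te hte]; exact cA
    · have hs' : s ∈ Icc 0 t := ⟨hte.1.trans hs.1, hs.2⟩
      rw [hb k s hs', hw k s hs', h0 k s hs', h1 k s hs', hw (k - 1) s hs', hb (k + 1) s hs']
      exact cB s hs

/-! ### The hypothesis package of the window one-step theorem along a solution -/

/-- **The bridge package along a solution of the chain.** For thin wavelet data (radius `≤ r`, centres
on `|ξ| = 1 + ε₀/4`), the seeded Toda structure constants `α` (coupling `D_c`, seed `ε̄ D_c`) and a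
solution `Y` of the exact Volterra chain on `[0,S)` from the carrier datum `A` at the front `0`
(continuous, no negative modes, `(1+ε₀)^{20n}`-bounded on compact sub-intervals): on every horizon
`0 < T < S` the critical observables `b = bvo Y`, `w = wvo Y` and the kernel majorants `M0o A Y`,
`M1o A Y` vanish below the front, are continuous on `[0,T]`, solve the C¹ critical Toda system with
memory errors `|b' − R(−b + G0)| ≤ ηRM0`, `|w' − R(−w + G1)| ≤ ηRM1` (rates `R_k = D_c(1+ε₀)^{2k}`),
obey `|b| ≤ M0`, `|w| ≤ M1`, the restart inequality of the majorants at rate `θR`, and carry an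
a-priori far tail `|b_{n+j}|, M_{n+j} ≤ lad j`, `|w_{n+j}| ≤ lad j/5` above any front `n ≥ 0`
(`chainCritical_of_kernels`, `chainCriticalC1_of_kernels`, `stub_tailOfWeight`).
[cite: Tao2016AveragedNS, §4 p. 22 (4.14)] -/
theorem stepExists_critical :
    ∀ {ε₀ : ℝ}, 0 < ε₀ → ε₀ ≤ 1 → ∀ (𝒟 : CascadeWaveletData ε₀ 2) (r Dc εb : ℝ)
      (α : Fin 2 → Fin 2 → Fin 2 → ℤ × ℤ × ℤ → ℝ) (kern : Fin 2 → ℤ → ℝ → ℝ)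
      (bvo wvo : (Fin 2 → ℤ → ℝ → ℝ) → ℤ → ℝ → ℝ) (M0o M1o : ℝ → (Fin 2 → ℤ → ℝ → ℝ) → ℤ → ℝ → ℝ)
      (q θ η : ℝ) (R : ℤ → ℝ) (lad : ℕ → ℝ),
      0 < r → r ≤ (1 + ε₀ / 4) / 2 → (∀ i, 𝒟.radius i ≤ r ∧ ‖𝒟.center i‖ = 1 + ε₀ / 4) →
      Dc = 4 * Real.pi ^ 2 * ((1 + ε₀ / 4) ^ 2 + r ^ 2) → 0 < εb →
      α = (fun (i₁ i₂ i₃ : Fin 2) (μ : ℤ × ℤ × ℤ) =>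
          if i₁ = 1 ∧ i₂ = 1 ∧ i₃ = 0 ∧ μ = (0, 0, 0) then Dc else
          if i₁ = 1 ∧ i₂ = 0 ∧ i₃ = 1 ∧ μ = (0, 0, 0) then -Dc / 2 else
          if i₁ = 0 ∧ i₂ = 1 ∧ i₃ = 1 ∧ μ = (0, 0, 0) then -Dc / 2 else
          if i₁ = 1 ∧ i₂ = 0 ∧ i₃ = 1 ∧ μ = (0, 1, 0) then Dc / 2 else
          if i₁ = 0 ∧ i₂ = 1 ∧ i₃ = 1 ∧ μ = (1, 0, 0) then Dc / 2 else
          if i₁ = 1 ∧ i₂ = 1 ∧ i₃ = 0 ∧ μ = (0, 0, 1) then -Dc else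
          if i₁ = 0 ∧ i₂ = 0 ∧ i₃ = 1 ∧ μ = (0, 0, 0) then εb * Dc else
          if i₁ = 0 ∧ i₂ = 1 ∧ i₃ = 0 ∧ μ = (0, 0, 0) then -(εb * Dc) / 2 else
          if i₁ = 1 ∧ i₂ = 0 ∧ i₃ = 0 ∧ μ = (0, 0, 0) then -(εb * Dc) / 2 else 0) →
      (∀ (i : Fin 2) (n : ℤ) (τ : ℝ),
        kern i n τ = (pairing (heat τ (cascadeWavelet ε₀ (𝒟.ψ i) n)) (cascadeWavelet ε₀ (𝒟.ψ i) n)).re) →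
      (∀ (Y : Fin 2 → ℤ → ℝ → ℝ) (n : ℤ) (t : ℝ), bvo Y n t = -((1 + ε₀) ^ ((n : ℝ) / 2) * Y 0 n t)) →
      (∀ (Y : Fin 2 → ℤ → ℝ → ℝ) (n : ℤ) (t : ℝ), wvo Y n t = (1 + ε₀) ^ ((n : ℝ) / 2) * Y 1 n t) →
      (∀ (A : ℝ) (Y : Fin 2 → ℤ → ℝ → ℝ) (n : ℤ) (t : ℝ), M0o A Y n t = (1 + ε₀) ^ ((n : ℝ) / 2) *
        ((if n = 0 then |A| else 0) * (∫ ξ, Real.exp (-(heatRate ξ * t)) * modeWeight 𝒟 0 n ξ) +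
          ∫ s in (0 : ℝ)..t, (∫ ξ, Real.exp (-(heatRate ξ * (t - s))) * modeWeight 𝒟 0 n ξ) *
            |quadTerm ε₀ α Y 0 n s|)) →
      (∀ (A : ℝ) (Y : Fin 2 → ℤ → ℝ → ℝ) (n : ℤ) (t : ℝ), M1o A Y n t = (1 + ε₀) ^ ((n : ℝ) / 2) *
        ∫ s in (0 : ℝ)..t, (∫ ξ, Real.exp (-(heatRate ξ * (t - s))) * modeWeight 𝒟 1 n ξ) *
          |quadTerm ε₀ α Y 1 n s|) →
      q = Real.sqrt (1 + ε₀) → θ = (1 + ε₀ / 4 - r) ^ 2 / ((1 + ε₀ / 4) ^ 2 + r ^ 2) →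
      η = 2 * (1 + ε₀ / 4) * r / ((1 + ε₀ / 4) ^ 2 + r ^ 2) →
      (∀ k : ℤ, R k = Dc * (1 + ε₀) ^ (2 * k)) →
      (∀ j : ℕ, lad j = εb * ((1 + ε₀) ^ (19 * (j - 2)))⁻¹) →
      ∀ (A S : ℝ) (Y : Fin 2 → ℤ → ℝ → ℝ) (G0 G1 : ℤ → ℝ → ℝ), 0 < S →
      (∀ i n, ContinuousOn (Y i n) (Ico 0 S)) → (∀ i n t, n < 0 → Y i n t = 0) →
      (∀ S' : ℝ, S' < S → ∃ C : ℝ, ∀ (i : Fin 2) (n : ℤ), ∀ t ∈ Icc 0 S',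
        (1 + ε₀) ^ ((20 : ℝ) * n) * |Y i n t| ≤ C) →
      (∀ (i : Fin 2) (n : ℤ), ∀ t ∈ Ico 0 S,
        Y i n t = (if i = 0 ∧ n = 0 then A else 0) * kern i n t +
          ∫ s in (0 : ℝ)..t, kern i n (t - s) * quadTerm ε₀ α Y i n s) →
      (∀ (k : ℤ) (t : ℝ), G0 k t =
        (wvo Y (k - 1) t) ^ 2 / q ^ 3 - (wvo Y k t) ^ 2 - εb * bvo Y k t * wvo Y k t) →
      (∀ (k : ℤ) (t : ℝ), G1 k t = wvo Y k t * (bvo Y k t - bvo Y (k + 1) t / q) + εb * (bvo Y k t) ^ 2) →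
      ∀ (n : ℤ) (T : ℝ), 0 ≤ n → 0 < T → T < S →
        (∀ k : ℤ, k < 0 → ∀ t ∈ Icc 0 T,
          bvo Y k t = 0 ∧ wvo Y k t = 0 ∧ M0o A Y k t = 0 ∧ M1o A Y k t = 0) ∧
        (∀ k : ℤ, ContinuousOn (bvo Y k) (Icc 0 T) ∧ ContinuousOn (wvo Y k) (Icc 0 T) ∧
          ContinuousOn (M0o A Y k) (Icc 0 T) ∧ ContinuousOn (M1o A Y k) (Icc 0 T)) ∧
        (∃ db dw : ℤ → ℝ → ℝ, ∀ k : ℤ, ContinuousOn (db k) (Icc 0 T) ∧ ContinuousOn (dw k) (Icc 0 T) ∧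
          ∀ t ∈ Ioo 0 T, HasDerivAt (bvo Y k) (db k t) t ∧
            |db k t - R k * (-(bvo Y k t) + G0 k t)| ≤ η * R k * M0o A Y k t ∧
            HasDerivAt (wvo Y k) (dw k t) t ∧
            |dw k t - R k * (-(wvo Y k t) + G1 k t)| ≤ η * R k * M1o A Y k t) ∧
        (∀ k : ℤ, ∀ t ∈ Icc 0 T, |bvo Y k t| ≤ M0o A Y k t ∧ |wvo Y k t| ≤ M1o A Y k t ∧
          0 ≤ M0o A Y k t ∧ 0 ≤ M1o A Y k t) ∧
        (∀ k : ℤ, ∀ t₁ ∈ Icc 0 T, ∀ t₂ ∈ Icc t₁ T,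
          M0o A Y k t₂ ≤ M0o A Y k t₁ * Real.exp (-(θ * R k * (t₂ - t₁))) +
            R k * ∫ u in t₁..t₂, Real.exp (-(θ * R k * (t₂ - u))) * |G0 k u| ∧
          M1o A Y k t₂ ≤ M1o A Y k t₁ * Real.exp (-(θ * R k * (t₂ - t₁))) +
            R k * ∫ u in t₁..t₂, Real.exp (-(θ * R k * (t₂ - u))) * |G1 k u|) ∧
        (∃ J : ℕ, ∀ j : ℕ, J ≤ j → ∀ t ∈ Icc 0 T,
          |bvo Y (n + j) t| ≤ lad j ∧ |wvo Y (n + j) t| ≤ lad j / 5 ∧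
          M0o A Y (n + j) t ≤ lad j ∧ M1o A Y (n + j) t ≤ lad j) := by
  intro ε₀ hε₀ hε₁ 𝒟 r Dc εb α kern bvo wvo M0o M1o q θ η R lad hr hr2 hD hDc hεb hα hkern hbvo hwvo
    hM0o hM1o hq hθ hη hR hlad A S Y G0 G1 hS hYc hlow hdec hchain hG0 hG1 n T hn hT hTS
  have hrρ : r < 1 + ε₀ / 4 := by linarith
  have hKD := fun i n => stub_kernelDeriv hε₀ hε₁ 𝒟 (1 + ε₀ / 4) r hr hrρ hD i n
  obtain ⟨-, -, hQ⟩ := stub_todaLegal Dc (εb * Dc)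
  have hρr : 0 < (1 + ε₀ / 4) ^ 2 + r ^ 2 := by positivity
  have hDc0 : 0 < Dc := by rw [hDc]; positivity
  have hQ0 : ∀ (n : ℤ) (t : ℝ), quadTerm ε₀ α Y 0 n t =
      Dc * (1 + ε₀) ^ ((5 : ℝ) * (n : ℝ) / 2) * Y 1 n t ^ 2 -
        Dc * (1 + ε₀) ^ ((5 : ℝ) * ((n : ℝ) - 1) / 2) * Y 1 (n - 1) t ^ 2 -
        εb * Dc * (1 + ε₀) ^ ((5 : ℝ) * (n : ℝ) / 2) * (Y 0 n t * Y 1 n t) := fun n t => by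
    rw [hα]; exact (hQ ε₀ Y n t).1
  have hQ1 : ∀ (n : ℤ) (t : ℝ), quadTerm ε₀ α Y 1 n t =
      Dc * (1 + ε₀) ^ ((5 : ℝ) * (n : ℝ) / 2) * (Y 1 n t * (Y 0 (n + 1) t - Y 0 n t)) +
        εb * Dc * (1 + ε₀) ^ ((5 : ℝ) * (n : ℝ) / 2) * Y 0 n t ^ 2 := fun n t => by
    rw [hα]; exact (hQ ε₀ Y n t).2
  have hκ : ∀ (i : Fin 2) (n : ℤ) (τ : ℝ), 0 ≤ τ →
      kern i n τ = ∫ ξ, Real.exp (-(heatRate ξ * τ)) * modeWeight 𝒟 i n ξ :=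
    fun i n τ hτ => (hkern i n τ).trans ((hKD i n).1 τ hτ)
  have hsum : ∀ n : ℤ, 4 * Real.pi ^ 2 * (1 + ε₀ / 4 - r) ^ 2 * (1 + ε₀) ^ (2 * n) +
      4 * Real.pi ^ 2 * (1 + ε₀ / 4 + r) ^ 2 * (1 + ε₀) ^ (2 * n) = 2 * R n := fun n => by
    rw [hR, hDc]; ring
  have hdiff : ∀ n : ℤ, 4 * Real.pi ^ 2 * (1 + ε₀ / 4 + r) ^ 2 * (1 + ε₀) ^ (2 * n) -
      4 * Real.pi ^ 2 * (1 + ε₀ / 4 - r) ^ 2 * (1 + ε₀) ^ (2 * n) = 2 * (η * R n) := fun n => by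
    rw [hR, hη, hDc]; field_simp; ring
  have hθ' : ∀ n : ℤ, 4 * Real.pi ^ 2 * (1 + ε₀ / 4 - r) ^ 2 * (1 + ε₀) ^ (2 * n) = θ * R n :=
    fun n => by rw [hR, hθ, hDc]; field_simp
  obtain ⟨h1, h2, -, -, h5, h6, -, -⟩ := chainCritical_of_kernels (θ := θ) (η := η) (q := q) (R := R)
    (K := fun i n τ => ∫ ξ, Real.exp (-(heatRate ξ * τ)) * modeWeight 𝒟 i n ξ)
    (bv := bvo Y) (wv := wvo Y) (G0 := G0) (G1 := G1) (M0 := M0o A Y) (M1 := M1o A Y) hε₀ (κ := kern)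
    (K₁ := fun i n τ => ∫ ξ, heatRate ξ * Real.exp (-(heatRate ξ * τ)) * modeWeight 𝒟 i n ξ)
    (Dlo := fun n => 4 * Real.pi ^ 2 * (1 + ε₀ / 4 - r) ^ 2 * (1 + ε₀) ^ (2 * n))
    (Dhi := fun n => 4 * Real.pi ^ 2 * (1 + ε₀ / 4 + r) ^ 2 * (1 + ε₀) ^ (2 * n))
    hκ (fun i n τ => (hKD i n).2.1 τ) (fun i n => (hKD i n).2.2.1)
    (fun i n => ((hKD i n).1 0 le_rfl).symm.trans (stub_kernel hε₀ hε₁ 𝒟 i n).1)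
    (fun i n τ hτ => (hKD i n).2.2.2 τ hτ) hsum hdiff hθ' hDc0 hR hq hYc hlow hchain hQ0 hQ1
    (hbvo Y) (hwvo Y) hG0 hG1 (hM0o A Y) (hM1o A Y) hT hTS
  obtain ⟨db, dw, hC1⟩ := chainCriticalC1_of_kernels (η := η) (q := q) (R := R)
    (K := fun i n τ => ∫ ξ, Real.exp (-(heatRate ξ * τ)) * modeWeight 𝒟 i n ξ)
    (bv := bvo Y) (wv := wvo Y) (G0 := G0) (G1 := G1) (M0 := M0o A Y) (M1 := M1o A Y) hε₀ (κ := kern)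
    (K₁ := fun i n τ => ∫ ξ, heatRate ξ * Real.exp (-(heatRate ξ * τ)) * modeWeight 𝒟 i n ξ)
    (Dlo := fun n => 4 * Real.pi ^ 2 * (1 + ε₀ / 4 - r) ^ 2 * (1 + ε₀) ^ (2 * n))
    (Dhi := fun n => 4 * Real.pi ^ 2 * (1 + ε₀ / 4 + r) ^ 2 * (1 + ε₀) ^ (2 * n))
    hκ (fun i n τ => (hKD i n).2.1 τ) (fun i n => (hKD i n).2.2.1)
    (fun i n => ((hKD i n).1 0 le_rfl).symm.trans (stub_kernel hε₀ hε₁ 𝒟 i n).1)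
    (fun i n τ hτ => (hKD i n).2.2.2 τ hτ) hsum hdiff hR hq hYc hchain hQ0 hQ1
    (hbvo Y) (hwvo Y) hG0 hG1 (hM0o A Y) (hM1o A Y) hT hTS
  obtain ⟨J, hJ⟩ := stub_tailOfWeight hε₀ hε₁ 𝒟 Dc εb 0 A S Y α (bvo Y) (wvo Y) (M0o A Y) (M1o A Y)
    hα hDc0 hεb hS hYc hlow hdec (hbvo Y) (hwvo Y) (hM0o A Y) (hM1o A Y) n T hn hT hTS
  refine ⟨h1, h2, ⟨db, dw, hC1⟩, h5, h6, J, fun j hj t ht => ?_⟩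
  rw [hlad]
  exact hJ j hj t ht

/-! ### The a-priori bound from the tube -/

/-- Class decay beats the `H¹⁰` weight: `(1+ε₀)^{10k}|x| ≤ (1+ε₀)^{20k}|x|` for `k ≥ 0`. [folklore] -/
theorem stepExists_weight_class {L c x : ℝ} (hL : 1 ≤ L) {k : ℤ} (hk : 0 ≤ k)
    (h : L ^ ((20 : ℝ) * k) * |x| ≤ c) : L ^ ((10 : ℝ) * k) * |x| ≤ c := by
  have hk' : (0 : ℝ) ≤ k := by exact_mod_cast hk
  exact (mul_le_mul_of_nonneg_right (Real.rpow_le_rpow_of_exponent_le hL (by nlinarith))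
    (abs_nonneg x)).trans h

/-- The `H¹⁰` weight against the critical weight below the front:
`(1+ε₀)^{10k}|x| = (1+ε₀)^{19k/2} (1+ε₀)^{k/2}|x| ≤ (1+ε₀)^{19N/2} c` for `k ≤ N`. [folklore] -/
theorem stepExists_weight_front {L c x : ℝ} (hL : 1 ≤ L) {k N : ℤ} (hkN : k ≤ N)
    (h : L ^ ((k : ℝ) / 2) * |x| ≤ c) : L ^ ((10 : ℝ) * k) * |x| ≤ L ^ ((19 : ℝ) / 2 * N) * c := by
  have hL0 : 0 < L := one_pos.trans_le hL
  have hkN' : (k : ℝ) ≤ N := by exact_mod_cast hkN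
  have hsplit : L ^ ((10 : ℝ) * k) = L ^ ((19 : ℝ) / 2 * k) * L ^ ((k : ℝ) / 2) := by
    rw [← Real.rpow_add hL0]; congr 1; ring
  rw [hsplit, mul_assoc]
  exact mul_le_mul (Real.rpow_le_rpow_of_exponent_le hL (by linarith)) h
    (mul_nonneg (Real.rpow_nonneg hL0.le _) (abs_nonneg x)) (Real.rpow_nonneg hL0.le _)

/-- The `H¹⁰` weight against the ladder profile above the front: for `k = n + j`, `j ≥ 2`,
`(1+ε₀)^{10k}|x| ≤ (1+ε₀)^{19k/2} ε̄ (1+ε₀)^{-19(j-2)} ≤ (1+ε₀)^{19n/2+19} ε̄`. [folklore] -/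
theorem stepExists_weight_tail {L εb x : ℝ} (hL : 1 ≤ L) (hεb : 0 ≤ εb) {k n : ℤ} {j : ℕ} (hj : 2 ≤ j)
    (hk : k = n + j) (h : L ^ ((k : ℝ) / 2) * |x| ≤ εb * (L ^ (19 * (j - 2)))⁻¹) :
    L ^ ((10 : ℝ) * k) * |x| ≤ L ^ ((19 : ℝ) / 2 * n + 19) * εb := by
  have hL0 : 0 < L := one_pos.trans_le hL
  have hj' : (2 : ℝ) ≤ j := by exact_mod_cast hj
  have hk' : (k : ℝ) = n + j := by rw [hk]; push_cast; ring
  have hprof : (L ^ (19 * (j - 2)))⁻¹ = L ^ (-(19 * ((j : ℝ) - 2))) := by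
    rw [← Real.rpow_natCast, ← Real.rpow_neg hL0.le]
    congr 1
    push_cast [Nat.cast_sub hj]
    ring
  have hsplit : L ^ ((10 : ℝ) * k) = L ^ ((19 : ℝ) / 2 * k) * L ^ ((k : ℝ) / 2) := by
    rw [← Real.rpow_add hL0]; congr 1; ring
  rw [hsplit, mul_assoc]
  calc L ^ ((19 : ℝ) / 2 * k) * (L ^ ((k : ℝ) / 2) * |x|)
      ≤ L ^ ((19 : ℝ) / 2 * k) * (εb * (L ^ (19 * (j - 2)))⁻¹) :=
        mul_le_mul_of_nonneg_left h (Real.rpow_nonneg hL0.le _)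
    _ = L ^ ((19 : ℝ) / 2 * k + -(19 * ((j : ℝ) - 2))) * εb := by
        rw [hprof, Real.rpow_add hL0]; ring
    _ ≤ L ^ ((19 : ℝ) / 2 * n + 19) * εb :=
        mul_le_mul_of_nonneg_right (Real.rpow_le_rpow_of_exponent_le hL (by rw [hk']; linarith)) hεb

/-- **The a-priori `H¹⁰` bound from the tube.** If a coefficient family without negative modes is in
the class (`(1+ε₀)^{20k}`-bounded) on `[0,t₀]` and stays in the one-step tube on `[t₀,T)`
(`|b_k|,|w_k| ≤ 2(bhi+3)` for `k ≤ n+1`, `|b_{n+j}|,|w_{n+j}| ≤ lad j = ε̄(1+ε₀)^{-19(j-2)}` for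
`j ≥ 2`), then `sup_{[0,T)} (1+ε₀)^{10k}|Y_{i,k}|` is finite. [folklore] -/
theorem stepExists_apriori (hε₀ : 0 < ε₀) (bvo wvo : (Fin 2 → ℤ → ℝ → ℝ) → ℤ → ℝ → ℝ) (lad : ℕ → ℝ)
    (hbvo : ∀ (Y : Fin 2 → ℤ → ℝ → ℝ) (n : ℤ) (t : ℝ), bvo Y n t = -((1 + ε₀) ^ ((n : ℝ) / 2) * Y 0 n t))
    (hwvo : ∀ (Y : Fin 2 → ℤ → ℝ → ℝ) (n : ℤ) (t : ℝ), wvo Y n t = (1 + ε₀) ^ ((n : ℝ) / 2) * Y 1 n t)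
    {εb : ℝ} (hεb : 0 ≤ εb) (hlad : ∀ j : ℕ, lad j = εb * ((1 + ε₀) ^ (19 * (j - 2)))⁻¹)
    {bhi : ℝ} (hbhi : 0 ≤ bhi + 3) {Y : Fin 2 → ℤ → ℝ → ℝ} {n : ℤ} {t₀ T : ℝ}
    (hlow : ∀ i k t, k < 0 → Y i k t = 0)
    (hcl : ∃ C : ℝ, ∀ (i : Fin 2) (k : ℤ), ∀ t ∈ Icc 0 t₀, (1 + ε₀) ^ ((20 : ℝ) * k) * |Y i k t| ≤ C)
    (htube : ∀ t ∈ Ico t₀ T,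
      (∀ k : ℤ, k ≤ n + 1 → |bvo Y k t| ≤ 2 * (bhi + 3) ∧ |wvo Y k t| ≤ 2 * (bhi + 3)) ∧
      (∀ j : ℕ, 2 ≤ j → |bvo Y (n + j) t| ≤ lad j ∧ |wvo Y (n + j) t| ≤ lad j)) :
    ∃ C : ℝ, ∀ (i : Fin 2) (k : ℤ), ∀ t ∈ Ico 0 T, (1 + ε₀) ^ ((10 : ℝ) * k) * |Y i k t| ≤ C := by
  have hL : 1 ≤ 1 + ε₀ := by linarith
  have hL0 : 0 < 1 + ε₀ := by linarith
  obtain ⟨C₁, hC₁⟩ := hcl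
  -- the observables as weighted absolute values
  have hobs : ∀ (i : Fin 2) (k : ℤ) (t : ℝ), (1 + ε₀) ^ ((k : ℝ) / 2) * |Y i k t| = |bvo Y k t| ∨
      (1 + ε₀) ^ ((k : ℝ) / 2) * |Y i k t| = |wvo Y k t| := by
    refine Fin.forall_fin_two.2 ⟨fun k t => Or.inl ?_, fun k t => Or.inr ?_⟩
    · rw [hbvo, abs_neg, abs_mul, abs_of_pos (Real.rpow_pos_of_pos hL0 _)]
    · rw [hwvo, abs_mul, abs_of_pos (Real.rpow_pos_of_pos hL0 _)]
  have hA0 : 0 ≤ max C₁ 0 := le_max_right _ _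
  have hB0 : 0 ≤ (1 + ε₀) ^ ((19 : ℝ) / 2 * (n + 1 : ℤ)) * (2 * (bhi + 3)) :=
    mul_nonneg (Real.rpow_nonneg hL0.le _) (by linarith)
  have hC0 : 0 ≤ (1 + ε₀) ^ ((19 : ℝ) / 2 * n + 19) * εb := mul_nonneg (Real.rpow_nonneg hL0.le _) hεb
  refine ⟨max C₁ 0 + (1 + ε₀) ^ ((19 : ℝ) / 2 * (n + 1 : ℤ)) * (2 * (bhi + 3)) +
    (1 + ε₀) ^ ((19 : ℝ) / 2 * n + 19) * εb, fun i k t ht => ?_⟩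
  rcases lt_or_ge k 0 with hk | hk
  · rw [hlow i k t hk, abs_zero, mul_zero]; linarith
  rcases le_or_gt t t₀ with htt | htt
  · have h := stepExists_weight_class hL hk (hC₁ i k t ⟨ht.1, htt⟩)
    linarith [le_max_left C₁ 0]
  obtain ⟨hfront, htail⟩ := htube t ⟨htt.le, ht.2⟩
  rcases le_or_gt k (n + 1) with hkn | hkn
  · have h1 : (1 + ε₀) ^ ((k : ℝ) / 2) * |Y i k t| ≤ 2 * (bhi + 3) := by
      rcases hobs i k t with h | h <;> rw [h]
      exacts [(hfront k hkn).1, (hfront k hkn).2]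
    have h := stepExists_weight_front hL hkn h1
    linarith
  · obtain ⟨j, hj, hkj⟩ : ∃ j : ℕ, 2 ≤ j ∧ k = n + j := ⟨(k - n).toNat, by omega, by omega⟩
    have h1 : (1 + ε₀) ^ ((k : ℝ) / 2) * |Y i k t| ≤ εb * ((1 + ε₀) ^ (19 * (j - 2)))⁻¹ := by
      rw [← hlad]
      rcases hobs i k t with h | h <;> rw [h, hkj]
      exacts [(htail j hj).1, (htail j hj).2]
    have h := stepExists_weight_tail hL hεb hj hkj h1
    linarith

/-! ### The registered tools stub -/

/-- **Registered tools stub `stub_stepExistsTools`** (line `Sketch` of crux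
`PerpetualPump.AveragedTypeIBlowup`, stmt-NavierStokesRegularity-1835): the three weight inequalities
behind the a-priori `H¹⁰` bound of a solution in the one-step tube — class decay
(`(1+ε₀)^{10k}|x| ≤ (1+ε₀)^{20k}|x|`, `k ≥ 0`), the front (`k ≤ N`) and the ladder tail
(`k = n + j`, `j ≥ 2`). [folklore] -/
theorem stub_stepExistsTools :
    (∀ (L c x : ℝ) (k : ℤ), 1 ≤ L → 0 ≤ k → L ^ ((20 : ℝ) * k) * |x| ≤ c → L ^ ((10 : ℝ) * k) * |x| ≤ c) ∧
    (∀ (L c x : ℝ) (k N : ℤ), 1 ≤ L → k ≤ N → L ^ ((k : ℝ) / 2) * |x| ≤ c →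
      L ^ ((10 : ℝ) * k) * |x| ≤ L ^ ((19 : ℝ) / 2 * N) * c) ∧
    (∀ (L εb x : ℝ) (k n : ℤ) (j : ℕ), 1 ≤ L → 0 ≤ εb → 2 ≤ j → k = n + j →
      L ^ ((k : ℝ) / 2) * |x| ≤ εb * (L ^ (19 * (j - 2)))⁻¹ →
      L ^ ((10 : ℝ) * k) * |x| ≤ L ^ ((19 : ℝ) / 2 * n + 19) * εb) :=
  ⟨fun _ _ _ _ hL hk h => stepExists_weight_class hL hk h,
    fun _ _ _ _ _ hL hkN h => stepExists_weight_front hL hkN h,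
    fun _ _ _ _ _ _ hL hεb hj hk h => stepExists_weight_tail hL hεb hj hk h⟩

end Summit.NavierStokesRegularity.NavierStokesRegularity.Theorems.PerpetualPumpAveragedTypeIBlowup

end
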